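import Literature.NumberTheory.Automorphic.UnitaryGroupSelfDualLocusRamified                      -- ★ (r1-A): `exists_mem_unitaryGroupOfForm_mul_of_selfDual_of_detClass`
import Literature.NumberTheory.Automorphic.UnitaryGroupIntegralPointsReductionRamified              -- ★ ramified residue facts; `valued_galAdicCompletionMap_sub_lt_one_of_ramified` (via Liu2021)
import Literature.NumberTheory.Automorphic.AdicCompletionUnitNorms                                 -- ★ `exists_sq_eq_of_sq_sub_mem_maximalIdeal` (Hensel for square roots)
import Literature.NumberTheory.EllipticCurves.Kramer1981.RamifiedNormIndexLocalLemmas             -- ★ `Kramer1981.henselianLocalRing_integer` (`𝒪` of a local field is Henselian)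
import HarnessLib

/-!
# `U(J)(L_w)` is transitive on the self-dual lattices of a hermitian PLANE at a TAMELY RAMIFIED place `w ∣ v` of a CM ∕ quadratic extension
# (Jacobowitz 1962, §8): the discharge of (two), (res), (norm₁) for `𝒪_w`

Topic `NumberTheory/Automorphic`; namespace `Literature.NumberTheory.Automorphic.UnitaryGroup`.  KERNEL ONLY (theorems; no definition, instance, notation, named fact,
`sorry`).  Cell `pub/hodgecm-mathlib`, F0∕P3a, crux H413 = stmt-HodgeConjecture-24833, line «N6nsGerm», (R2) Euler–Poincaré road, RAMIFIED half (census
`F0/P3a/A-p06/g27/CENSUS-R2ram-RamifiedEulerPoincare.A-p06g27.md` §5 (r1-B); LEAD F0P3a-plan (g10) T9-8 (B); seat A-p06 (g27); consumer = the transitivity binder `hA`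
of A-p17 (g22)'s (T4) and of (N2b-lattice) at a ramified `w`).  HONEST LABEL: HC_CM is proved only modulo the printed citations until rung 0 closes.

At a place `w ∣ v` of the quadratic extension `E ∕ F` with `c • w = w` (non-split) and `e(w|v) ≠ 1` (RAMIFIED), for `E_w = w.adicCompletion E`, `σ_w = galAdicCompletionMap c hw`,
`𝒪_w = 𝒪[E_w]`: (res) `σ_w r − r ∈ 𝔪_w` for `r ∈ 𝒪_w` is ★ `valued_galAdicCompletionMap_sub_lt_one_of_ramified`; (norm₁) «a `σ_w`-fixed principal unit `u` is a norm»
follows from HENSEL in the complete d.v.r. `𝒪_w` (★ `exists_sq_eq_of_sq_sub_mem_maximalIdeal`: `u = s²`) and (res): `σ s = ± s`, and `σ s = −s` would put `2s`, hence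
`u`, in `𝔪_w` — so `σ s = s` and `u = s σ(s)`; (two) `2 ∈ 𝒪_w^×` is the TAMENESS hypothesis `v ∤ 2`, carried as a binder; `𝓀_w` is finite (★).  Feeding these to ★
(r1-A) `exists_mem_unitaryGroupOfForm_mul_of_selfDual_of_detClass`:

* §1 (generic) **`exists_mul_map_eq_of_map_eq_of_sub_one_mem`** — in a Henselian local DOMAIN with `2` a unit and a residually trivial involution `σ`, every `σ`-fixed
  principal unit is a norm `t σ t`.
* §2 **`exists_mem_unitaryGroupOfForm_mul_of_selfDual_of_ramified`** — at a ramified non-split `w ∣ v` with `2 ∈ 𝒪_w^×`, for a `σ_w`-hermitian `J ∈ GL₂(𝒪_w)`: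
  every `g ∈ GL₂(E_w)` whose Gram matrix `(σ_w g)ᵀ J g` lies in `GL₂(𝒪_w)` is `u k`, `u ∈ U(J)(E_w)`, `k ∈ GL₂(𝒪_w)` — the ramified companion of ★
  `exists_mem_unitaryGroupOfForm_mul_of_selfDual_of_nonsplit` (inert).

## References
* [Jacobowitz1962] R. Jacobowitz, *Hermitian forms over local fields*, Amer. J. Math. 84 (1962), §8.
* [Serre1979] J.-P. Serre, *Local Fields*, Ch. II §4 Prop. 7 (Hensel), Ch. V §3 (tame ramification).
* [Kottwitz1992] R. E. Kottwitz, JAMS 5 (1992), §7 Cor. 7.3.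
-/

set_option autoImplicit false

open NumberField IsDedekindDomain
open scoped Matrix ValuativeRel
open ValuativeRel

namespace Literature.NumberTheory.Automorphic.UnitaryGroup

open Literature.NumberTheory.Automorphic

/-! ## §1 Hensel: `σ`-fixed principal units are norms -/

/-- **A `σ`-fixed principal unit is a norm** in a Henselian local domain `R` with `2 ∈ R^×` and a residually trivial involution `σ` (`σ r − r ∈ 𝔪`): if `σ u = u` and
`u ≡ 1 (mod 𝔪)` then `u = t · σ t` — Hensel gives `u = s²`; `σ s = ± s`, and `σ s = −s` would give `2 s ∈ 𝔪`, `u = s² ∈ 𝔪`. [cite: Serre1979, Ch. II §4 Prop. 7]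
[cite: Jacobowitz1962, §8] -/
theorem exists_mul_map_eq_of_map_eq_of_sub_one_mem {R : Type*} [CommRing R] [IsDomain R] [HenselianLocalRing R] (τ : R →+* R) (h2 : IsUnit (2 : R))
    (hres : ∀ r : R, τ r - r ∈ IsLocalRing.maximalIdeal R) (u : R) (hτu : τ u = u) (hu : u - 1 ∈ IsLocalRing.maximalIdeal R) :
    ∃ t : R, t * τ t = u := by
  have h1u : (1 : R) ^ 2 - u ∈ IsLocalRing.maximalIdeal R := by
    have : (1 : R) ^ 2 - u = -(u - 1) := by ring
    rw [this]
    exact (Ideal.neg_mem_iff _).2 hu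
  obtain ⟨s, hs⟩ := exists_sq_eq_of_sq_sub_mem_maximalIdeal h2 isUnit_one h1u
  -- `u` is a unit
  have huu : IsUnit u := by
    by_contra hnu
    have hmem : u ∈ IsLocalRing.maximalIdeal R := (IsLocalRing.mem_maximalIdeal _).2 (mem_nonunits_iff.2 hnu)
    have h1 : (1 : R) ∈ IsLocalRing.maximalIdeal R := by
      have := Ideal.sub_mem _ hmem hu
      rwa [sub_sub_cancel] at this
    exact (IsLocalRing.maximalIdeal.isMaximal R).ne_top ((Ideal.eq_top_iff_one _).2 h1)
  -- `τ s = ± s`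
  have hsq : (τ s - s) * (τ s + s) = 0 := by
    have h1 : τ s ^ 2 = s ^ 2 := by rw [← map_pow, hs, hτu]
    linear_combination h1
  rcases mul_eq_zero.1 hsq with h | h
  · exact ⟨s, by rw [sub_eq_zero.1 h, ← pow_two, hs]⟩
  · -- `τ s = −s` is impossible: `2 s = −(τ s − s) ∈ 𝔪`, so `s ∈ 𝔪`, so `u = s² ∈ 𝔪`
    exfalso
    have hτs : τ s = -s := eq_neg_of_add_eq_zero_left h
    have h2s : 2 * s ∈ IsLocalRing.maximalIdeal R := by
      have : 2 * s = -(τ s - s) := by rw [hτs]; ring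
      rw [this]
      exact (Ideal.neg_mem_iff _).2 (hres s)
    have hsm : s ∈ IsLocalRing.maximalIdeal R := by
      obtain ⟨two, htwo⟩ := h2
      have : s = ((two⁻¹ : Rˣ) : R) * (2 * s) := by rw [← mul_assoc, ← htwo, Units.inv_mul, one_mul]
      rw [this]
      exact Ideal.mul_mem_left _ _ h2s
    have hum : u ∈ IsLocalRing.maximalIdeal R := by
      rw [← hs, pow_two]
      exact Ideal.mul_mem_left _ _ hsm
    exact (IsLocalRing.mem_maximalIdeal _).1 hum huu

/-! ## §2 At a tamely ramified non-split place of a quadratic extension of number fields -/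

section NumberField

variable {F E : Type} [Field F] [NumberField F] [Field E] [NumberField E] [Algebra F E]
  [Algebra.IsQuadraticExtension F E] (c : E ≃ₐ[F] E) {v : HeightOneSpectrum (𝓞 F)} (w : PlacesOver E v)

/-- **`U(J)(E_w)` is transitive on self-dual `𝒪_w`-lattices of a hermitian PLANE at a TAMELY RAMIFIED place** (`v` ramified in `E`: `e(w|v) ≠ 1`; `w ∣ v` with `c • w = w`,
`c ≠ 1`; tame: `2 ∈ 𝒪_w^×`), for the local Galois involution `σ_w = galAdicCompletionMap c hw` and a `σ_w`-hermitian `J ∈ GL₂(𝒪_w)`: every `g ∈ GL₂(E_w)` with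
`(σ_w g)ᵀ J g ∈ GL₂(𝒪_w)` is `u k`, `u ∈ U(J)(E_w)`, `k ∈ GL₂(𝒪_w)` (★ (r1-A) with (res) ★ `valued_galAdicCompletionMap_sub_lt_one_of_ramified`, (norm₁) §1 in the
Henselian `𝒪_w`, `𝓀_w` finite ★). [cite: Jacobowitz1962, §8] [cite: Kottwitz1992, §7 Cor. 7.3] -/
theorem exists_mem_unitaryGroupOfForm_mul_of_selfDual_of_ramified (hc1 : c ≠ 1) (hw : c • w.1 = w.1)
    (he : v.asIdeal.ramificationIdx' w.1.asIdeal ≠ 1) (h2 : IsUnit (2 : 𝒪[w.1.adicCompletion E]))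
    (J : GL (Fin 2) (w.1.adicCompletion E)) (hJ : J ∈ glInt 2 (w.1.adicCompletion E))
    (hJh : ((J : Matrix (Fin 2) (Fin 2) (w.1.adicCompletion E)).map (galAdicCompletionMap (L := E) c hw))ᵀ = J)
    (g : GL (Fin 2) (w.1.adicCompletion E))
    (hg : ∃ J' ∈ glInt 2 (w.1.adicCompletion E), (J' : Matrix (Fin 2) (Fin 2) (w.1.adicCompletion E)) =
      formCongr (galAdicCompletionMap (L := E) c hw) g (J : Matrix (Fin 2) (Fin 2) (w.1.adicCompletion E))) :
    ∃ u ∈ unitaryGroupOfForm (galAdicCompletionMap (L := E) c hw) (J : Matrix (Fin 2) (Fin 2) (w.1.adicCompletion E)),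
      ∃ k ∈ glInt 2 (w.1.adicCompletion E), g = u * k := by
  classical
  set K := w.1.adicCompletion E
  set σ := galAdicCompletionMap (L := E) c hw with hσdef
  haveI : HenselianLocalRing 𝒪[K] := Literature.NumberTheory.EllipticCurves.Kramer1981.henselianLocalRing_integer
  have hσσ : ∀ x, σ (σ x) = x := galAdicCompletionMap_galAdicCompletionMap_of_smul_eq c w hc1 hw
  have hσO : ∀ x : 𝒪[K], σ x ∈ 𝒪[K] := fun x => mem_integer_galAdicCompletionMap c v w hw x
  have hσv : ∀ x : K, valuation K (σ x) = valuation K x := fun x => valuation_galAdicCompletionMap_eq c v w hw x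
  -- the bridge `𝔪_w = {valuation < 1} = {Valued.v < 1}`
  have hmem : ∀ x : 𝒪[K], x ∈ IsLocalRing.maximalIdeal 𝒪[K] ↔ Valued.v (x : K) < 1 := fun x => by
    rw [← IsLocalRing.residue_eq_zero_iff, residue_eq_zero_iff_valuation_lt_one, ← Valuation.vlt_one_iff (valuation K),
      Valuation.vlt_one_iff (Valued.v : Valuation K (WithZero (Multiplicative ℤ)))]
  have hle : ∀ x : 𝒪[K], Valued.v (x : K) ≤ 1 := fun x => by
    rw [← Valuation.vle_one_iff (Valued.v : Valuation K (WithZero (Multiplicative ℤ))), Valuation.vle_one_iff (valuation K)]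
    exact (Valuation.mem_integer_iff _ _).1 x.2
  -- (res)
  have hres : ∀ r : 𝒪[K], (⟨σ r, hσO r⟩ : 𝒪[K]) - r ∈ IsLocalRing.maximalIdeal 𝒪[K] := fun r => by
    rw [hmem]
    exact Liu2021.LemD1IndexedNonVacuityRamifiedConverse.valued_galAdicCompletionMap_sub_lt_one_of_ramified E c v hc1 w hw he (r : K) (hle r)
  -- (norm₁)
  set τ : 𝒪[K] →+* 𝒪[K] := (σ.comp (𝒪[K]).subtype).codRestrict (𝒪[K]) fun x => hσO x with hτdef
  have hresτ : ∀ r : 𝒪[K], τ r - r ∈ IsLocalRing.maximalIdeal 𝒪[K] := hres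
  have hnorm₁ : ∀ u : 𝒪[K], σ u = u → u - 1 ∈ IsLocalRing.maximalIdeal 𝒪[K] → ∃ t : 𝒪[K], (t : K) * σ t = u := by
    intro u hu h1
    obtain ⟨t, ht⟩ := exists_mul_map_eq_of_map_eq_of_sub_one_mem τ h2 hresτ u (Subtype.ext hu) h1
    exact ⟨t, congrArg Subtype.val ht⟩
  exact exists_mem_unitaryGroupOfForm_mul_of_selfDual_of_detClass σ hσσ hσO hσv h2 hres hnorm₁ J hJ hJh g hg

end NumberField

end Literature.NumberTheory.Automorphic.UnitaryGroup
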